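import Summits.ResolutionOfSingularities.ResolutionOfSingularities.Theorems.FrobeniusLadderFInjectiveMacaulayficationWeightCoaction
import Mathlib.Algebra.Polynomial.Laurent
import Mathlib.RingTheory.MvPolynomial.WeightedHomogeneous
import Mathlib.Algebra.MvPolynomial.Rename
import Mathlib.RingTheory.Ideal.Span
import HarnessLib

/-!
# (F0) THE FILTERED REES CARRIER: `f^h = Σ_b c_b X^b s^{w·b − D}` in `k[X, s]`, its homogeneity, its fibres at `s = 0` and `s = 1`
# (crux `FInjectiveMacaulayfication`, line `graded-engine` §17 filtered engine G4♮ — CRUX-PLAN v5 §1.3 piece (F0))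

Support file for crux stmt-ResolutionOfSingularities-15315 (`FrobeniusLadder.FInjectiveMacaulayfication`), chain w45a,
seat res-L1-w45a-stub-3 (owner of (F0)/(F4)/(F5), seat table v5). [OURS · L1 W4.5a] — NOT a statement of the manuscript;
AI-written, weaker than expert review.

The filtered engine G4♮ (`FilteredEngine.stub_filteredChartClause`, `L/w45a/FilteredEngineSig.lean`) runs the graded proof of G4
on the EXTENDED REES ALGEBRA of the `w`-order filtration of `R = k[X]/(f)` (`f` arbitrary, `D = ord_w f`, `f₀ = in_w f`):
`ℛ = k[X, s]/(f^h)`, `f^h := Σ_b c_b X^b s^{w·b − D}`, `T′♮ = ℛ[1/X_v^c]`. THE CARRIER (fixed here, imported by (F1)–(F6)):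

* ambient ring `A := MvPolynomial (Option (Fin n)) k` — `s := X none`, `X_j := X (some j)` (embedding `rename some`);
* `ℤ`-weights `fun o => o.elim (-1) (fun j => (w j : ℤ))` (`deg s = −1`, `deg X_j = w_j`), always written as this lambda;
* the carrier polynomial as a HYPOTHESIS
  `hfh : fh = ∑ b ∈ f.support, monomial (Finsupp.mapDomain some b + Finsupp.single none (Finsupp.weight w b − D)) (coeff b f)`
  (natural subtraction; faithful because `hD0 : ∀ m < D, weightedHomogeneousComponent w m f = 0` forces `D ≤ w·b` on the support);
* `ℛ := A ⧸ Ideal.span {fh}`, `T′♮ := Localization.Away (Ideal.Quotient.mk (Ideal.span {fh}) (X (some v)) ^ c)`.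

Proved here (all `[folklore]`, glue on Mathlib; no definitions, no named facts):

* `weight_carrierExponent` — the `ℤ`-weight of `X^b s^e` is `w·b − e`; `le_weight_of_mem_support` — `D ≤ w·b` on the support;
* `fh_isWeightedHomogeneous` — **`f^h` is `(w, −1)`-weighted homogeneous of weight `D`**;
* `aeval_CT_monomial`, `aeval_CT_of_isWeightedHomogeneous` — the TWISTED EVALUATION (`𝔾ₘ`-coaction) identity in stub-4's
  `single`/`C·T^m` convention, for ANY index type, `ℤ`-weights and any `k`-algebra map `φ : k[X_σ] → S`:
  `aeval (o ↦ C (φ X_o) · T^{deg o}) g = C (φ g) · T^m` for `g` weighted homogeneous of weight `m` — instantiated with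
  `φ = algebraMap ∘ mk` it is exactly the input of `WeightCoaction.exists_coaction`'s descent-and-extend pattern on `ℛ`, `T′♮` ((F1));
  `coaction_fh` — the instance `φ = id`: `β(f^h) = f^h · T^D`;
* `fh_sub_rename_initialForm_mem` — **`f^h ≡ f₀ (mod s)`**: `fh − rename some (weightedHomogeneousComponent w D f) ∈ (X none)` ((F4): the
  fibre `ℛ/(s)` is the cone `k[X]/(f₀)`);
* `aeval_one_fh` — **`f^h|_{s = 1} = f`**: `aeval (o ↦ o.elim 1 X) fh = f` ((F4)/(F5): `ℛ[1/s] ≅ R[s^{±1}]`);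
* `aeval_zero_rename`, `not_X_none_dvd_fh`, `fh_ne_zero` — `s ∤ f^h` and `f^h ≠ 0` as soon as `f₀ ≠ 0`.
-/

-- single-problem summit: the doubled namespace component is forced
set_option linter.dupNamespace false

noncomputable section

open scoped LaurentPolynomial
open LaurentPolynomial

namespace Summit.ResolutionOfSingularities.ResolutionOfSingularities.Theorems.FInjectiveMacaulayfication.FilteredReesCarrier

variable {k : Type} [Field k] {n : ℕ} (w : Fin n → ℕ)

/-! ## Weights of the carrier exponents -/

/-- The `(w, −1)`-weight of the exponent vector of `X^b s^e` is `w·b − e`. [folklore] -/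
theorem weight_carrierExponent (b : Fin n →₀ ℕ) (e : ℕ) :
    Finsupp.weight (fun o : Option (Fin n) => o.elim (-1 : ℤ) (fun j => (w j : ℤ)))
      (Finsupp.mapDomain some b + Finsupp.single none e) = (Finsupp.weight w b : ℤ) - e := by
  classical
  rw [map_add, Finsupp.weight_apply, Finsupp.weight_apply, Finsupp.weight_apply,
    Finsupp.sum_mapDomain_index (h := fun i c => c • (Option.elim i (-1 : ℤ) fun j => (w j : ℤ)))
      (fun _ => zero_smul ℕ _) (fun _ _ _ => add_smul _ _ _),
    Finsupp.sum_single_index (h := fun i c => c • (Option.elim i (-1 : ℤ) fun j => (w j : ℤ))) (zero_smul ℕ _)]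
  simp only [Option.elim_some, Option.elim_none, smul_eq_mul, nsmul_eq_mul, Finsupp.sum, Nat.cast_sum, Nat.cast_mul,
    mul_comm]
  ring

/-- If all weighted-homogeneous components of `f` below `D` vanish, every exponent in the support of `f` has weight `≥ D`.
[folklore] -/
theorem le_weight_of_mem_support (D : ℕ) (f : MvPolynomial (Fin n) k)
    (hD0 : ∀ m < D, MvPolynomial.weightedHomogeneousComponent w m f = 0) {b : Fin n →₀ ℕ} (hb : b ∈ f.support) :
    D ≤ Finsupp.weight w b := by
  classical
  by_contra h
  have h1 := hD0 (Finsupp.weight w b) (by omega)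
  have h2 := MvPolynomial.coeff_weightedHomogeneousComponent (w := w) (Finsupp.weight w b) f b
  rw [h1, MvPolynomial.coeff_zero, if_pos rfl] at h2
  exact (MvPolynomial.mem_support_iff.mp hb) h2.symm

/-! ## Homogeneity of `f^h` -/

/-- **`f^h = Σ_b c_b X^b s^{w·b − D}` is `(w, −1)`-weighted homogeneous of weight `D`.** [folklore] -/
theorem fh_isWeightedHomogeneous (D : ℕ) (f : MvPolynomial (Fin n) k) (fh : MvPolynomial (Option (Fin n)) k)
    (hfh : fh = ∑ b ∈ f.support, MvPolynomial.monomial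
      (Finsupp.mapDomain some b + Finsupp.single none (Finsupp.weight w b - D)) (MvPolynomial.coeff b f))
    (hD0 : ∀ m < D, MvPolynomial.weightedHomogeneousComponent w m f = 0) :
    MvPolynomial.IsWeightedHomogeneous (fun o : Option (Fin n) => o.elim (-1 : ℤ) (fun j => (w j : ℤ))) fh (D : ℤ) := by
  rw [hfh]
  refine MvPolynomial.IsWeightedHomogeneous.sum _ _ _ fun b hb => MvPolynomial.isWeightedHomogeneous_monomial _ _ _ ?_
  rw [weight_carrierExponent, Nat.cast_sub (le_weight_of_mem_support w D f hD0 hb)]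
  ring

/-! ## The twisted evaluation (coaction) identity -/

/-- **Twisted evaluation of a monomial**: `X^d ↦ C(φ X^d)·T^{deg d}` under `X_o ↦ C(φ X_o)·T^{deg o}`. [folklore] -/
theorem aeval_CT_monomial {σ : Type} (deg : σ → ℤ) (S : Type) [CommRing S] [Algebra k S]
    (φ : MvPolynomial σ k →ₐ[k] S) (d : σ →₀ ℕ) (r : k) :
    MvPolynomial.aeval (fun o : σ => C (φ (MvPolynomial.X o)) * T (deg o)) (MvPolynomial.monomial d r) =
      C (φ (MvPolynomial.monomial d r)) * T (Finsupp.weight deg d) := by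
  classical
  have hC : φ (MvPolynomial.C r) = algebraMap k S r := by
    rw [← MvPolynomial.algebraMap_eq]
    exact φ.commutes r
  rw [MvPolynomial.aeval_monomial, MvPolynomial.monomial_eq, map_mul, map_mul, Finsupp.prod, Finsupp.prod,
    map_prod, map_prod, Finsupp.weight_apply, Finsupp.sum, hC]
  simp only [mul_pow, ← map_pow, Finset.prod_mul_distrib, T_pow, WeightCoaction.prod_T,
    WeightCoaction.algebraMap_laurent, nsmul_eq_mul, mul_assoc]

/-- **Twisted evaluation of a weighted homogeneous polynomial** (the coaction identity, in the `C·T^m` = `single m`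
convention): for `g` weighted homogeneous of weight `m` for `ℤ`-valued weights `deg`, and any `k`-algebra map `φ`,
`aeval (o ↦ C(φ X_o)·T^{deg o}) g = C(φ g)·T^m`. [folklore] -/
theorem aeval_CT_of_isWeightedHomogeneous {σ : Type} (deg : σ → ℤ) (S : Type) [CommRing S] [Algebra k S]
    (φ : MvPolynomial σ k →ₐ[k] S) {g : MvPolynomial σ k} {m : ℤ} (hg : MvPolynomial.IsWeightedHomogeneous deg g m) :
    MvPolynomial.aeval (fun o : σ => C (φ (MvPolynomial.X o)) * T (deg o)) g = C (φ g) * T m := by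
  classical
  conv_lhs => rw [MvPolynomial.as_sum g]
  conv_rhs => rw [MvPolynomial.as_sum g]
  rw [map_sum, map_sum, map_sum, Finset.sum_mul]
  refine Finset.sum_congr rfl fun b hb => ?_
  rw [aeval_CT_monomial, hg (MvPolynomial.mem_support_iff.mp hb)]

/-- **The coaction identity for `f^h` on the carrier itself**: `β(f^h) = C f^h · T^D` for
`β : X_j ↦ C X_j · T^{w_j}, s ↦ C s · T^{−1}`. [folklore] -/
theorem coaction_fh (D : ℕ) (f : MvPolynomial (Fin n) k) (fh : MvPolynomial (Option (Fin n)) k)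
    (hfh : fh = ∑ b ∈ f.support, MvPolynomial.monomial
      (Finsupp.mapDomain some b + Finsupp.single none (Finsupp.weight w b - D)) (MvPolynomial.coeff b f))
    (hD0 : ∀ m < D, MvPolynomial.weightedHomogeneousComponent w m f = 0) :
    MvPolynomial.aeval (fun o : Option (Fin n) => C (MvPolynomial.X o : MvPolynomial (Option (Fin n)) k) *
        T (o.elim (-1 : ℤ) (fun j => (w j : ℤ)))) fh = C fh * T (D : ℤ) := by
  have h := aeval_CT_of_isWeightedHomogeneous (fun o : Option (Fin n) => o.elim (-1 : ℤ) (fun j => (w j : ℤ)))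
    (MvPolynomial (Option (Fin n)) k) (AlgHom.id k _) (fh_isWeightedHomogeneous w D f fh hfh hD0)
  simpa only [AlgHom.id_apply] using h

/-! ## The fibre at `s = 0`: `f^h ≡ f₀` -/

/-- **`f^h ≡ in_w f (mod s)`**: `fh − rename some (weightedHomogeneousComponent w D f)` lies in the ideal `(s) = (X none)`
(terms of weight exactly `D` carry no `s`; the others carry a positive power of `s`). [folklore] -/
theorem fh_sub_rename_initialForm_mem (D : ℕ) (f : MvPolynomial (Fin n) k) (fh : MvPolynomial (Option (Fin n)) k)
    (hfh : fh = ∑ b ∈ f.support, MvPolynomial.monomial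
      (Finsupp.mapDomain some b + Finsupp.single none (Finsupp.weight w b - D)) (MvPolynomial.coeff b f))
    (hD0 : ∀ m < D, MvPolynomial.weightedHomogeneousComponent w m f = 0) :
    fh - MvPolynomial.rename some (MvPolynomial.weightedHomogeneousComponent w D f) ∈
      Ideal.span {(MvPolynomial.X none : MvPolynomial (Option (Fin n)) k)} := by
  classical
  rw [hfh, MvPolynomial.weightedHomogeneousComponent_apply, map_sum, Finset.sum_filter, ← Finset.sum_sub_distrib]
  refine Submodule.sum_mem _ fun b hb => ?_
  have hDb := le_weight_of_mem_support w D f hD0 hb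
  by_cases hbD : Finsupp.weight w b = D
  · -- weight exactly `D`: no `s`
    rw [if_pos hbD, MvPolynomial.rename_monomial, hbD, Nat.sub_self, Finsupp.single_zero, add_zero, sub_self]
    exact Ideal.zero_mem _
  · -- weight `> D`: a positive power of `s` factors out
    rw [if_neg hbD, sub_zero]
    obtain ⟨e, he⟩ : ∃ e : ℕ, Finsupp.weight w b - D = e + 1 := ⟨Finsupp.weight w b - D - 1, by omega⟩
    have hfac : MvPolynomial.monomial (Finsupp.mapDomain some b + Finsupp.single none (Finsupp.weight w b - D))
        (MvPolynomial.coeff b f) =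
        MvPolynomial.monomial (Finsupp.mapDomain some b + Finsupp.single none e) (MvPolynomial.coeff b f) *
          (MvPolynomial.X none : MvPolynomial (Option (Fin n)) k) := by
      rw [he, MvPolynomial.X, MvPolynomial.monomial_mul, mul_one, add_assoc, ← Finsupp.single_add]
    rw [hfac]
    exact Ideal.mul_mem_left _ _ (Ideal.subset_span rfl)

/-! ## The fibre at `s = 1`: `f^h|_{s=1} = f` -/

/-- **`f^h` at `s = 1` is `f`**: `aeval (o ↦ o.elim 1 X) fh = f`. [folklore] -/
theorem aeval_one_fh (D : ℕ) (f : MvPolynomial (Fin n) k) (fh : MvPolynomial (Option (Fin n)) k)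
    (hfh : fh = ∑ b ∈ f.support, MvPolynomial.monomial
      (Finsupp.mapDomain some b + Finsupp.single none (Finsupp.weight w b - D)) (MvPolynomial.coeff b f)) :
    MvPolynomial.aeval (fun o : Option (Fin n) => o.elim (1 : MvPolynomial (Fin n) k) MvPolynomial.X) fh = f := by
  classical
  rw [hfh, map_sum]
  conv_rhs => rw [MvPolynomial.as_sum f]
  refine Finset.sum_congr rfl fun b _ => ?_
  rw [MvPolynomial.aeval_monomial, Finsupp.prod_add_index' (fun _ => pow_zero _) (fun _ _ _ => pow_add _ _ _),
    Finsupp.prod_mapDomain_index (h := fun o m => (Option.elim o (1 : MvPolynomial (Fin n) k) MvPolynomial.X) ^ m)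
      (fun _ => pow_zero _) (fun _ _ _ => pow_add _ _ _),
    Finsupp.prod_single_index (h := fun o m => (Option.elim o (1 : MvPolynomial (Fin n) k) MvPolynomial.X) ^ m)
      (pow_zero _)]
  simp only [Option.elim_some, Option.elim_none, one_pow, mul_one, MvPolynomial.algebraMap_eq]
  rw [MvPolynomial.monomial_eq]

/-! ## `s ∤ f^h` -/

/-- Setting `s = 0` undoes `rename some`: `aeval (o ↦ o.elim 0 X) (rename some g) = g`. [folklore] -/
theorem aeval_zero_rename (g : MvPolynomial (Fin n) k) :
    MvPolynomial.aeval (fun o : Option (Fin n) => o.elim (0 : MvPolynomial (Fin n) k) MvPolynomial.X)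
      (MvPolynomial.rename some g) = g := by
  rw [MvPolynomial.aeval_rename]
  exact MvPolynomial.aeval_X_left_apply g

/-- **`s ∤ f^h`** as soon as the initial form `f₀ = weightedHomogeneousComponent w D f` is non-zero (set `s = 0`: `f^h ↦ f₀`).
[folklore] -/
theorem not_X_none_dvd_fh (D : ℕ) (f : MvPolynomial (Fin n) k) (fh : MvPolynomial (Option (Fin n)) k)
    (hfh : fh = ∑ b ∈ f.support, MvPolynomial.monomial
      (Finsupp.mapDomain some b + Finsupp.single none (Finsupp.weight w b - D)) (MvPolynomial.coeff b f))
    (hD0 : ∀ m < D, MvPolynomial.weightedHomogeneousComponent w m f = 0)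
    (hD : MvPolynomial.weightedHomogeneousComponent w D f ≠ 0) :
    ¬ (MvPolynomial.X none : MvPolynomial (Option (Fin n)) k) ∣ fh := by
  intro hdvd
  apply hD
  have h1 : (MvPolynomial.X none : MvPolynomial (Option (Fin n)) k) ∣
      MvPolynomial.rename some (MvPolynomial.weightedHomogeneousComponent w D f) := by
    have h2 := Ideal.mem_span_singleton.mp (fh_sub_rename_initialForm_mem w D f fh hfh hD0)
    have h3 := dvd_sub hdvd h2
    rwa [sub_sub_cancel] at h3
  obtain ⟨q, hq⟩ := h1
  have h4 := congrArg (MvPolynomial.aeval (fun o : Option (Fin n) => o.elim (0 : MvPolynomial (Fin n) k) MvPolynomial.X)) hq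
  rw [aeval_zero_rename, map_mul, MvPolynomial.aeval_X] at h4
  simpa using h4

/-- **`f^h ≠ 0`** as soon as `f₀ ≠ 0`. [folklore] -/
theorem fh_ne_zero (D : ℕ) (f : MvPolynomial (Fin n) k) (fh : MvPolynomial (Option (Fin n)) k)
    (hfh : fh = ∑ b ∈ f.support, MvPolynomial.monomial
      (Finsupp.mapDomain some b + Finsupp.single none (Finsupp.weight w b - D)) (MvPolynomial.coeff b f))
    (hD0 : ∀ m < D, MvPolynomial.weightedHomogeneousComponent w m f = 0)
    (hD : MvPolynomial.weightedHomogeneousComponent w D f ≠ 0) : fh ≠ 0 := fun h0 =>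
  not_X_none_dvd_fh w D f fh hfh hD0 hD (h0 ▸ dvd_zero _)

end Summit.ResolutionOfSingularities.ResolutionOfSingularities.Theorems.FInjectiveMacaulayfication.FilteredReesCarrier

end
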